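/-
Copyright: statement-level skeleton of a published paper (lit-balaban cell, Phase-2 proof seat p39 gen 6). No proof claims
beyond what the kernel checks below.
-/
import Literature.MathematicalPhysics.QuantumFieldTheory.Balaban1983to89.B3Bound316

/-!
# B3 — T. Bałaban, *(Higgs)₂,₃ quantum fields in a finite volume. III. Renormalization*, CMP **88** (1983) 411–445
[Balaban1983Higgs3], p. 437 [PDF 27]: the LATTICE CONVOLUTION ESTIMATE behind *"the corresponding inequalities for
derivatives"* for the kernel `M = G^ξ_{j″}(0)(1 − m²_{j″} − a_{j″}P_{j″})C^ξ` of (3.16) — the product of two kernels with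
the `|y − y′|^{−2}e^{−δ|y−y′|}` singularity of a differentiated propagator in `d = 3`, possibly with a unit-block-local
operator in between, has again a kernel bounded by `O(1)|y − y′|^{−2}e^{−δ′|y−y′|}` off the diagonal, UNIFORMLY in the
lattice spacing `ξ ≤ 1` and in the volume

statement-level skeleton of published theorems with citation tags; proofs where landed; nothing here is a claim about
the Yang–Mills mass gap

PDF held: `paper:balaban1983-higgs-2-3-quantum-fields-finite-volume` (journal page = PDF page + 410); p. 437 [PDF 27] read in
the OCR text (`p0027.txt`).  Row **B3.Eq3.11-3.17** of `HOME/lit-balaban-r15/ROWS-B3.md` (fold owner r15), sub-display (3.16)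
and the sentence after it: *"Using the inequalities |C^ξ(y − y′)| ≦ O(1)e^{−½|y−y′|}/|y − y′|, |G^ξ_{j″}(0; y, y′)| ≦
O(1)e^{−δ₀|y−y′|}/|y − y′|, and the corresponding inequalities for derivatives, we can estimate (3.16) by a constant."*
The derivative kernel of (3.16) is `Σ_ν(∂^ξ_νM∂^{ξ*}_ν)(y,y′)` with `M = G^ξ_{j″}(0)(1 − m²_{j″} − a_{j″}P_{j″})C^ξ` a PRODUCT of
operators; p20's `B3Bound316.abs_bracket316_le` takes the bound `|(∂^ξ_νM∂^{ξ*}_ν)(y,y′)| ≤ B′e^{−δ|y−y′|}/|y−y′|²` as its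
hypothesis `hM`.  THIS FILE supplies the elementary analysis that turns the printed bounds on the FACTORS into that bound on the
PRODUCT (used by `B3Bound316ZeroTorus` for the zero-field torus instance); it is model-free: kernels `A`, `E`, `B` on a torus
level `Site P j` with the volume element `ξ^d`, `d = 3`.
* (private) `exp_neg_le_two_div_sq` — `e^{−x} ≤ 2/x²` (`x > 0`).
* `supDist_triangle'` — the triangle inequality of the `ℓ^∞` torus distance (a private re-derivation of p08's
  `BIJ85Ineq722Torus.supDist_triangle`, to keep this file's imports to `B3Bound316`).
* `sum_profile_le` — `Σ_z ξ³·a·(ξ·max(1,|y−z|_∞))^{−2}e^{−αξ|y−z|_∞} ≤ a(1 + radialConst 3 α ξ 0)` (`0 < ξ ≤ 1`): the diagonal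
  term `ξ³·ξ^{−2} ≤ 1` plus p20's Riemann radial sum `B3TorusRadialSums.riemann_radial_sum_le` (κ = 2, p = 0).
* **`conv_le_offdiag`** — if `|A(y,z)|`, `|B(z,y′)|` are bounded at ALL sites by the profiles `a·(ξ max(1,|y−z|))^{−2}e^{−αξ|y−z|}`,
  `b·(…)^{−2}e^{−βξ|z−y′|}`, then for `y′ ≠ y`: `Σ_z ξ³|A(y,z)||B(z,y′)| ≤ 4ab(2 + R_α + R_β)·(ξ|y−y′|)^{−2}e^{−γξ|y−y′|}` for every
  `0 ≤ γ` with `2γ ≤ α`, `2γ ≤ β` (`R_c = radialConst 3 c ξ 0`).  Mechanism: for each `z` one of `|y−z|`, `|z−y′|` is `≥ ½|y−y′|`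
  (triangle inequality), and there the factor is bounded by `4·(its constant)·(ξ|y−y′|)^{−2}e^{−γξ|y−y′|}`; the other factor is summed.
* **`conv_block_le`** — the same with a block-local kernel in between: if moreover `|E(z,z′)| ≤ e₁ξ³` and `E(z,z′) ≠ 0 ⇒
  ξ|z−z′|_∞ ≤ 2` (a kernel supported on pairs in a common unit block, e.g. `a_kP_k`), then for `y′ ≠ y` and `0 < γ`, `2γ ≤ α, β`:
  `Σ_{z,z′}ξ³|A(y,z)||E(z,z′)||B(z′,y′)| ≤ 8e₁ab·e^{2γ}(1 + R_{α/2})(1 + R_{β/2})γ^{−2}·(ξ|y−y′|)^{−2}e^{−(γ/2)ξ|y−y′|}` (half of each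
  exponential is kept for the decay through `ξ|y−z| + ξ|z′−y′| ≥ ξ|y−y′| − 2`, the two remaining sums factor, and
  `e^{−(γ/2)t} ≤ 8γ^{−2}t^{−2}`).
Mathlib + `B3Bound316` (`radialConst`, `B3TorusRadialSums`) only; theorems only, no definitions, no named facts; standard axioms.
Unit `lit-balaban-p39-g6` (Phase-2 proof seat p39, gen 6), HOME `run/shared/lean/pub/lit-balaban/`, 2026-08-21.
-/

open scoped BigOperators

namespace Literature.MathematicalPhysics.QuantumFieldTheory.Balaban1983to89.B3KernelConvolutionTorus

open LatticeFieldCalculus B3Sect3ScalarSelfEnergy B3TorusRadialSums B3Bound316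

noncomputable section

/-! ## 1. Two elementary tools -/

/-- kernel: `e^{−x} ≤ 2/x²` for `x > 0` (from `x²/2 ≤ e^x`; private twin of the tree's
`Literature.NumberTheory.Automorphic.exp_neg_le_two_div_sq`, whose module is not worth importing here). [folklore] -/
private theorem exp_neg_le_two_div_sq {x : ℝ} (hx : 0 < x) : Real.exp (-x) ≤ 2 / x ^ 2 := by
  have h := Real.pow_div_factorial_le_exp x hx.le 2
  rw [Nat.factorial_two, Nat.cast_ofNat] at h
  have hx2 : 0 < x ^ 2 := by positivity
  rw [Real.exp_neg, inv_eq_one_div, div_le_div_iff₀ (Real.exp_pos x) hx2]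
  linarith

section Triangle

variable {N : ℕ} [NeZero N]

/-- kernel: subadditivity of the circular size on `ℤ/N` (p08's `BIJ85Ineq722Torus.cdist_add_le`, re-derived to keep the
imports small). [folklore] -/
private theorem cdist_add_le (a b : ZMod N) : cdist (a + b) ≤ cdist a + cdist b := by
  unfold cdist
  rcases le_total a.val (-a).val with ha | ha <;> rcases le_total b.val (-b).val with hb | hb
  · rw [min_eq_left ha, min_eq_left hb]
    exact (min_le_left _ _).trans (ZMod.val_add_le a b)
  · rw [min_eq_left ha, min_eq_right hb]
    rcases le_total (-b).val a.val with h | h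
    · have e : a + b = a - -b := by ring
      calc min (a + b).val (-(a + b)).val ≤ (a + b).val := min_le_left _ _
        _ = a.val - (-b).val := by rw [e, ZMod.val_sub h]
        _ ≤ a.val + (-b).val := by omega
    · have e : -(a + b) = -b - a := by ring
      calc min (a + b).val (-(a + b)).val ≤ (-(a + b)).val := min_le_right _ _
        _ = (-b).val - a.val := by rw [e, ZMod.val_sub h]
        _ ≤ a.val + (-b).val := by omega
  · rw [min_eq_right ha, min_eq_left hb]
    rcases le_total (-a).val b.val with h | h
    · have e : a + b = b - -a := by ring
      calc min (a + b).val (-(a + b)).val ≤ (a + b).val := min_le_left _ _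
        _ = b.val - (-a).val := by rw [e, ZMod.val_sub h]
        _ ≤ (-a).val + b.val := by omega
    · have e : -(a + b) = -a - b := by ring
      calc min (a + b).val (-(a + b)).val ≤ (-(a + b)).val := min_le_right _ _
        _ = (-a).val - b.val := by rw [e, ZMod.val_sub h]
        _ ≤ (-a).val + b.val := by omega
  · rw [min_eq_right ha, min_eq_right hb]
    have e : -(a + b) = -a + -b := by ring
    calc min (a + b).val (-(a + b)).val ≤ (-(a + b)).val := min_le_right _ _
      _ ≤ (-a).val + (-b).val := by rw [e]; exact ZMod.val_add_le _ _

end Triangle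

variable {P : Params} {j : ℕ}

/-- The triangle inequality of the `ℓ^∞` torus distance `|x − y| = max_μ min{|x_μ − y_μ|, 2L_μ − |x_μ − y_μ|}`
(= p08's `BIJ85Ineq722Torus.supDist_triangle`). [cite: Balaban1982Higgs1, (1.3) p.604] -/
theorem supDist_triangle' (x y z : Site P j) : supDist x z ≤ supDist x y + supDist y z := by
  rw [supDist_eq_sup_cdist, supDist_eq_sup_cdist, supDist_eq_sup_cdist]
  refine Finset.sup_le fun μ hμ => ?_
  have e1 : x μ - z μ = (x μ - y μ) + (y μ - z μ) := by ring
  rw [e1]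
  exact (cdist_add_le _ _).trans (add_le_add (Finset.le_sup (f := fun μ => cdist (x μ - y μ)) hμ)
    (Finset.le_sup (f := fun μ => cdist (y μ - z μ)) hμ))

/-- The triangle inequality with real casts. [cite: Balaban1982Higgs1, (1.3) p.604] -/
theorem supDist_triangle_real (x y z : Site P j) : (supDist x z : ℝ) ≤ (supDist x y : ℝ) + (supDist y z : ℝ) := by
  exact_mod_cast supDist_triangle' x y z

/-! ## 2. The radial profile and its lattice sum -/

/-- kernel: off the diagonal the regularised radius is the torus distance (1.3): `max(1, |y − z|) = |y − z|` for `z ≠ y`.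
[cite: Balaban1982Higgs1, (1.3) p.604] -/
theorem max_one_supDist_of_ne {y z : Site P j} (hne : z ≠ y) : max (1 : ℝ) (supDist y z : ℝ) = (supDist y z : ℝ) := by
  have h0 : supDist y z ≠ 0 := fun h => hne (((supDist_eq_zero_iff y z).mp h).symm)
  have h1 : (1 : ℝ) ≤ (supDist y z : ℝ) := by exact_mod_cast Nat.one_le_iff_ne_zero.mpr h0
  exact max_eq_right h1

/-- kernel: on the diagonal (`|y − y| = 0`, (1.3)) the regularised radius is `1`. [cite: Balaban1982Higgs1, (1.3) p.604] -/
theorem max_one_supDist_self (y : Site P j) : max (1 : ℝ) (supDist y y : ℝ) = 1 := by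
  rw [(supDist_eq_zero_iff y y).mpr rfl, Nat.cast_zero]
  exact max_eq_left zero_le_one

/-- kernel: the torus distance (1.3) of distinct sites is `≥ 1` (as a real). [cite: Balaban1982Higgs1, (1.3) p.604] -/
theorem one_le_supDist_of_ne {y z : Site P j} (hne : z ≠ y) : (1 : ℝ) ≤ (supDist y z : ℝ) := by
  have h0 : supDist y z ≠ 0 := fun h => hne (((supDist_eq_zero_iff y z).mp h).symm)
  exact_mod_cast Nat.one_le_iff_ne_zero.mpr h0

/-- **The lattice sum of the profile**, `d = 3`, `0 < ξ ≤ 1`: `Σ_z ξ³·(ξ·max(1,|y − z|))^{−2}e^{−αξ|y−z|} ≤ 1 + radialConst 3 α ξ 0`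
— the diagonal term is `ξ ≤ 1`, the rest is the Riemann radial sum of `B3TorusRadialSums` with the integrable singularity `|y − z|^{−2}`.
[cite: Balaban1983Higgs3, (3.16) p.437] -/
theorem sum_profile_le (hd : P.d = 3) {ξ : ℝ} (hξ : 0 < ξ) (hξ1 : ξ ≤ 1) {α : ℝ} (hα : 0 < α) (y : Site P j) :
    ∑ z : Site P j, ξ ^ P.d * (((ξ * max (1 : ℝ) (supDist y z : ℝ)) ^ 2)⁻¹ * Real.exp (-(α * (ξ * (supDist y z : ℝ))))) ≤
      1 + radialConst P.d α ξ 0 := by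
  classical
  set F : Site P j → ℝ := fun z =>
    ξ ^ P.d * (((ξ * max (1 : ℝ) (supDist y z : ℝ)) ^ 2)⁻¹ * Real.exp (-(α * (ξ * (supDist y z : ℝ))))) with hF
  have hsplit : ∑ z : Site P j, F z = F y + ∑ z ∈ Finset.univ.filter (fun z : Site P j => z ≠ y), F z := by
    rw [← Finset.add_sum_erase Finset.univ F (Finset.mem_univ y)]
    congr 1
    refine Finset.sum_congr ?_ fun _ _ => rfl
    ext z; simp [Finset.mem_erase]
  have hdiag : F y ≤ 1 := by
    simp only [hF, (supDist_eq_zero_iff y y).mpr rfl, Nat.cast_zero, mul_zero, neg_zero, Real.exp_zero, mul_one,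
      max_eq_left (zero_le_one : (0 : ℝ) ≤ 1)]
    rw [hd]
    have : ξ ^ 3 * (ξ ^ 2)⁻¹ = ξ := by field_simp
    rw [this]; exact hξ1
  have hoff : ∑ z ∈ Finset.univ.filter (fun z : Site P j => z ≠ y), F z ≤ radialConst P.d α ξ 0 := by
    have h := riemann_radial_sum_le y hα hξ (κ := 2) (p := 0) (by omega)
    have heq : ∀ z ∈ Finset.univ.filter (fun z : Site P j => z ≠ y),
        F z = ξ ^ P.d * (((ξ * supDist y z) ^ 2)⁻¹ * Real.exp (-(α * (ξ * supDist y z)))) := by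
      intro z hz
      rw [hF]
      simp only [max_one_supDist_of_ne (Finset.mem_filter.mp hz).2]
    rw [Finset.sum_congr rfl heq]
    simpa [radialConst] using h
  rw [hsplit]
  exact add_le_add hdiag hoff

/-- The profile sum with a constant in front. [cite: Balaban1983Higgs3, (3.16) p.437] -/
theorem sum_const_mul_profile_le (hd : P.d = 3) {ξ : ℝ} (hξ : 0 < ξ) (hξ1 : ξ ≤ 1) {α a : ℝ} (hα : 0 < α) (ha : 0 ≤ a)
    (y : Site P j) :
    ∑ z : Site P j, ξ ^ P.d * (a * (((ξ * max (1 : ℝ) (supDist y z : ℝ)) ^ 2)⁻¹ *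
        Real.exp (-(α * (ξ * (supDist y z : ℝ)))))) ≤ a * (1 + radialConst P.d α ξ 0) := by
  have h := sum_profile_le hd hξ hξ1 hα y
  have heq : ∑ z : Site P j, ξ ^ P.d * (a * (((ξ * max (1 : ℝ) (supDist y z : ℝ)) ^ 2)⁻¹ *
      Real.exp (-(α * (ξ * (supDist y z : ℝ)))))) =
      a * ∑ z : Site P j, ξ ^ P.d * (((ξ * max (1 : ℝ) (supDist y z : ℝ)) ^ 2)⁻¹ *
        Real.exp (-(α * (ξ * (supDist y z : ℝ))))) := by
    rw [Finset.mul_sum]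
    exact Finset.sum_congr rfl fun z _ => by ring
  rw [heq]
  exact mul_le_mul_of_nonneg_left h ha

/-- The same profile sum in the second variable (symmetry of the distance). [cite: Balaban1983Higgs3, (3.16) p.437] -/
theorem sum_const_mul_profile_le' (hd : P.d = 3) {ξ : ℝ} (hξ : 0 < ξ) (hξ1 : ξ ≤ 1) {α a : ℝ} (hα : 0 < α) (ha : 0 ≤ a)
    (y : Site P j) :
    ∑ z : Site P j, ξ ^ P.d * (a * (((ξ * max (1 : ℝ) (supDist z y : ℝ)) ^ 2)⁻¹ *
        Real.exp (-(α * (ξ * (supDist z y : ℝ)))))) ≤ a * (1 + radialConst P.d α ξ 0) := by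
  simp only [supDist_comm _ y]
  exact sum_const_mul_profile_le hd hξ hξ1 hα ha y

/-! ## 3. The factor that carries half of the distance -/

/-- kernel: if `|y − y′| ≤ 2|w|` for a lattice distance `|w| = n_w` (so `n_w ≥ 1` when `y′ ≠ y`), a profile at `w` with rate `c ≥ 2γ`
is at most `4·(ξ|y−y′|)^{−2}e^{−γξ|y−y′|}`. [cite: Balaban1983Higgs3, (3.16) p.437] -/
theorem profile_le_of_half {ξ : ℝ} (hξ : 0 < ξ) {c γ : ℝ} (hγ : 0 ≤ γ) (hγc : 2 * γ ≤ c) {n nw : ℕ} (hn : 1 ≤ n)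
    (h2 : n ≤ 2 * nw) :
    ((ξ * max (1 : ℝ) (nw : ℝ)) ^ 2)⁻¹ * Real.exp (-(c * (ξ * (nw : ℝ)))) ≤
      4 * (((ξ * (n : ℝ)) ^ 2)⁻¹ * Real.exp (-(γ * (ξ * (n : ℝ))))) := by
  have hnw1 : 1 ≤ nw := by omega
  have hmax : max (1 : ℝ) (nw : ℝ) = (nw : ℝ) := max_eq_right (by exact_mod_cast hnw1)
  rw [hmax]
  have hn0 : (0 : ℝ) < n := by exact_mod_cast hn
  have hnw0 : (0 : ℝ) < nw := by exact_mod_cast hnw1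
  have h2r : (n : ℝ) ≤ 2 * (nw : ℝ) := by exact_mod_cast h2
  -- the power
  have hpow : ((ξ * (nw : ℝ)) ^ 2)⁻¹ ≤ 4 * ((ξ * (n : ℝ)) ^ 2)⁻¹ := by
    rw [show (4 : ℝ) * ((ξ * (n : ℝ)) ^ 2)⁻¹ = ((ξ * (n : ℝ) / 2) ^ 2)⁻¹ by
      rw [div_pow, inv_div, div_eq_mul_inv]; ring]
    apply inv_anti₀ (by positivity)
    have hle : ξ * (n : ℝ) ≤ ξ * (2 * (nw : ℝ)) := mul_le_mul_of_nonneg_left h2r hξ.le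
    have hle' : ξ * (n : ℝ) / 2 ≤ ξ * (nw : ℝ) := by linarith
    exact pow_le_pow_left₀ (by positivity) hle' 2
  -- the exponential
  have hexp : Real.exp (-(c * (ξ * (nw : ℝ)))) ≤ Real.exp (-(γ * (ξ * (n : ℝ)))) := by
    apply Real.exp_le_exp.mpr
    have h1 : γ * (ξ * (n : ℝ)) ≤ γ * (ξ * (2 * (nw : ℝ))) := by gcongr
    nlinarith [mul_nonneg hξ.le hnw0.le]
  calc ((ξ * (nw : ℝ)) ^ 2)⁻¹ * Real.exp (-(c * (ξ * (nw : ℝ))))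
      ≤ (4 * ((ξ * (n : ℝ)) ^ 2)⁻¹) * Real.exp (-(γ * (ξ * (n : ℝ)))) :=
        mul_le_mul hpow hexp (Real.exp_pos _).le (by positivity)
    _ = _ := by ring

/-! ## 4. Two singular kernels convolved: the off-diagonal bound -/

/-- **CONVOLUTION OF TWO `|y − z|^{−2}`-SINGULAR KERNELS WITH EXPONENTIAL TAILS** (`d = 3`, volume element `ξ³`, `0 < ξ ≤ 1`): if
`|A(y,z)| ≤ a(ξ·max(1,|y−z|))^{−2}e^{−αξ|y−z|}` and `|B(z,y′)| ≤ b(ξ·max(1,|z−y′|))^{−2}e^{−βξ|z−y′|}` at ALL sites, then for `y′ ≠ y`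
and every `0 ≤ γ` with `2γ ≤ α`, `2γ ≤ β`:
`Σ_z ξ³|A(y,z)||B(z,y′)| ≤ 4ab(2 + radialConst 3 α ξ 0 + radialConst 3 β ξ 0)·(ξ|y−y′|)^{−2}e^{−γξ|y−y′|}` — the shape of the
hypothesis `hM` of `B3Bound316.abs_bracket316_le`, uniformly in the volume. [cite: Balaban1983Higgs3, (3.16) p.437] -/
theorem conv_le_offdiag (hd : P.d = 3) {ξ : ℝ} (hξ : 0 < ξ) (hξ1 : ξ ≤ 1) {α β γ a b : ℝ} (hα : 0 < α) (hβ : 0 < β)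
    (hγ : 0 ≤ γ) (hγα : 2 * γ ≤ α) (hγβ : 2 * γ ≤ β) (ha : 0 ≤ a) (hb : 0 ≤ b) (A B : Kernel P j)
    (hA : ∀ y z : Site P j, |A y z| ≤
      a * (((ξ * max (1 : ℝ) (supDist y z : ℝ)) ^ 2)⁻¹ * Real.exp (-(α * (ξ * (supDist y z : ℝ))))))
    (hB : ∀ z y' : Site P j, |B z y'| ≤
      b * (((ξ * max (1 : ℝ) (supDist z y' : ℝ)) ^ 2)⁻¹ * Real.exp (-(β * (ξ * (supDist z y' : ℝ))))))
    {y y' : Site P j} (hne : y' ≠ y) :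
    ∑ z : Site P j, ξ ^ P.d * (|A y z| * |B z y'|) ≤
      4 * a * b * (2 + radialConst P.d α ξ 0 + radialConst P.d β ξ 0) *
        (((ξ * (supDist y y' : ℝ)) ^ 2)⁻¹ * Real.exp (-(γ * (ξ * (supDist y y' : ℝ))))) := by
  classical
  set n : ℕ := supDist y y' with hn
  have hn1 : 1 ≤ n := by
    by_contra h0
    exact hne (((supDist_eq_zero_iff y y').mp (by omega)).symm)
  set W : ℝ := ((ξ * (n : ℝ)) ^ 2)⁻¹ * Real.exp (-(γ * (ξ * (n : ℝ)))) with hW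
  have hW0 : 0 ≤ W := by positivity
  -- the two profiles (with their constants)
  set u : Site P j → ℝ := fun z => ξ ^ P.d * (a * (((ξ * max (1 : ℝ) (supDist y z : ℝ)) ^ 2)⁻¹ *
    Real.exp (-(α * (ξ * (supDist y z : ℝ)))))) with hu
  set v : Site P j → ℝ := fun z => ξ ^ P.d * (b * (((ξ * max (1 : ℝ) (supDist z y' : ℝ)) ^ 2)⁻¹ *
    Real.exp (-(β * (ξ * (supDist z y' : ℝ)))))) with hv
  have hu0 : ∀ z, 0 ≤ u z := fun z => by positivity
  have hv0 : ∀ z, 0 ≤ v z := fun z => by positivity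
  have hξd : 0 ≤ ξ ^ P.d := by positivity
  -- pointwise: one of the two factors carries half of the distance
  have hpt : ∀ z : Site P j, ξ ^ P.d * (|A y z| * |B z y'|) ≤ 4 * W * (b * u z + a * v z) := by
    intro z
    have htri : n ≤ supDist y z + supDist z y' := supDist_triangle' y z y'
    by_cases hcase : n ≤ 2 * supDist z y'
    · -- `B` carries the distance, `A` is summed
      have hBz : |B z y'| ≤ b * (4 * W) := by
        refine (hB z y').trans (mul_le_mul_of_nonneg_left ?_ hb)
        exact profile_le_of_half hξ hγ hγβ hn1 hcase
      calc ξ ^ P.d * (|A y z| * |B z y'|) ≤ ξ ^ P.d * ((a * (((ξ * max (1 : ℝ) (supDist y z : ℝ)) ^ 2)⁻¹ *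
              Real.exp (-(α * (ξ * (supDist y z : ℝ)))))) * (b * (4 * W))) := by
            refine mul_le_mul_of_nonneg_left ?_ hξd
            exact mul_le_mul (hA y z) hBz (abs_nonneg _) (by positivity)
        _ = 4 * W * (b * u z) := by rw [hu]; ring
        _ ≤ 4 * W * (b * u z + a * v z) := by
            have : 0 ≤ 4 * W * (a * v z) := by positivity
            nlinarith
    · -- `A` carries the distance, `B` is summed
      have hcase' : n ≤ 2 * supDist y z := by omega
      have hAz : |A y z| ≤ a * (4 * W) := by
        refine (hA y z).trans (mul_le_mul_of_nonneg_left ?_ ha)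
        exact profile_le_of_half hξ hγ hγα hn1 hcase'
      calc ξ ^ P.d * (|A y z| * |B z y'|) ≤ ξ ^ P.d * ((a * (4 * W)) * (b * (((ξ * max (1 : ℝ) (supDist z y' : ℝ)) ^ 2)⁻¹ *
              Real.exp (-(β * (ξ * (supDist z y' : ℝ))))))) := by
            refine mul_le_mul_of_nonneg_left ?_ hξd
            exact mul_le_mul (hAz) (hB z y') (abs_nonneg _) (by positivity)
        _ = 4 * W * (a * v z) := by rw [hv]; ring
        _ ≤ 4 * W * (b * u z + a * v z) := by
            have : 0 ≤ 4 * W * (b * u z) := by positivity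
            nlinarith
  -- the two sums
  have hsu : ∑ z, u z ≤ a * (1 + radialConst P.d α ξ 0) := sum_const_mul_profile_le hd hξ hξ1 hα ha y
  have hsv : ∑ z, v z ≤ b * (1 + radialConst P.d β ξ 0) := sum_const_mul_profile_le' hd hξ hξ1 hβ hb y'
  calc ∑ z : Site P j, ξ ^ P.d * (|A y z| * |B z y'|) ≤ ∑ z : Site P j, 4 * W * (b * u z + a * v z) :=
        Finset.sum_le_sum fun z _ => hpt z
    _ = 4 * W * (b * ∑ z, u z + a * ∑ z, v z) := by
        rw [← Finset.mul_sum, Finset.sum_add_distrib, Finset.mul_sum, Finset.mul_sum]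
    _ ≤ 4 * W * (b * (a * (1 + radialConst P.d α ξ 0)) + a * (b * (1 + radialConst P.d β ξ 0))) := by
        gcongr
    _ = 4 * a * b * (2 + radialConst P.d α ξ 0 + radialConst P.d β ξ 0) * W := by ring

/-! ## 5. Two singular kernels with a unit-block-local operator in between -/

/-- **THE SAME CONVOLUTION THROUGH A BLOCK-LOCAL KERNEL** (`d = 3`, `0 < ξ ≤ 1`): if in addition `|E(z,z′)| ≤ e₁ξ³` everywhere and
`E(z,z′) ≠ 0` only when `ξ|z − z′|_∞ ≤ 2` (a kernel supported on pairs of a common unit block, such as `a_kP_k` of (3.16) on the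
`ξ = L^{−k}`-lattice), then for `y′ ≠ y` and every `0 < γ` with `2γ ≤ α`, `2γ ≤ β`:
`Σ_{z,z′}ξ³|A(y,z)||E(z,z′)||B(z′,y′)| ≤ 8e₁ab·e^{2γ}(1 + radialConst 3 (α/2) ξ 0)(1 + radialConst 3 (β/2) ξ 0)·γ^{−2}·
(ξ|y−y′|)^{−2}e^{−(γ/2)ξ|y−y′|}`. [cite: Balaban1983Higgs3, (3.16) p.437] -/
theorem conv_block_le (hd : P.d = 3) {ξ : ℝ} (hξ : 0 < ξ) (hξ1 : ξ ≤ 1) {α β γ a b e₁ : ℝ} (hα : 0 < α) (hβ : 0 < β)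
    (hγ : 0 < γ) (hγα : 2 * γ ≤ α) (hγβ : 2 * γ ≤ β) (ha : 0 ≤ a) (hb : 0 ≤ b) (he : 0 ≤ e₁) (A E B : Kernel P j)
    (hA : ∀ y z : Site P j, |A y z| ≤
      a * (((ξ * max (1 : ℝ) (supDist y z : ℝ)) ^ 2)⁻¹ * Real.exp (-(α * (ξ * (supDist y z : ℝ))))))
    (hB : ∀ z y' : Site P j, |B z y'| ≤
      b * (((ξ * max (1 : ℝ) (supDist z y' : ℝ)) ^ 2)⁻¹ * Real.exp (-(β * (ξ * (supDist z y' : ℝ))))))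
    (hE : ∀ z z' : Site P j, |E z z'| ≤ e₁ * ξ ^ P.d)
    (hEs : ∀ z z' : Site P j, E z z' ≠ 0 → ξ * (supDist z z' : ℝ) ≤ 2)
    {y y' : Site P j} (hne : y' ≠ y) :
    ∑ z : Site P j, ∑ z' : Site P j, ξ ^ P.d * (|A y z| * |E z z'| * |B z' y'|) ≤
      8 * e₁ * a * b * Real.exp (2 * γ) * (1 + radialConst P.d (α / 2) ξ 0) * (1 + radialConst P.d (β / 2) ξ 0) *
        (γ ^ 2)⁻¹ * (((ξ * (supDist y y' : ℝ)) ^ 2)⁻¹ * Real.exp (-(γ / 2 * (ξ * (supDist y y' : ℝ))))) := by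
  classical
  set n : ℕ := supDist y y' with hn
  have hn1 : 1 ≤ n := by
    by_contra h0
    exact hne (((supDist_eq_zero_iff y y').mp (by omega)).symm)
  have hn0 : (0 : ℝ) < n := by exact_mod_cast hn1
  set t : ℝ := ξ * (n : ℝ) with ht
  have ht0 : 0 < t := mul_pos hξ hn0
  have hξd : 0 ≤ ξ ^ P.d := by positivity
  -- the half-rate profiles
  set u : Site P j → ℝ := fun z => ξ ^ P.d * (a * (((ξ * max (1 : ℝ) (supDist y z : ℝ)) ^ 2)⁻¹ *
    Real.exp (-(α / 2 * (ξ * (supDist y z : ℝ)))))) with hu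
  set v : Site P j → ℝ := fun z' => ξ ^ P.d * (b * (((ξ * max (1 : ℝ) (supDist z' y' : ℝ)) ^ 2)⁻¹ *
    Real.exp (-(β / 2 * (ξ * (supDist z' y' : ℝ)))))) with hv
  have hu0 : ∀ z, 0 ≤ u z := fun z => by positivity
  have hv0 : ∀ z, 0 ≤ v z := fun z => by positivity
  set K : ℝ := e₁ * Real.exp (2 * γ) * Real.exp (-(γ * t)) with hK
  have hK0 : 0 ≤ K := by positivity
  -- pointwise bound for every pair
  have hpt : ∀ z z' : Site P j, ξ ^ P.d * (|A y z| * |E z z'| * |B z' y'|) ≤ K * (u z * v z') := by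
    intro z z'
    by_cases hE0 : E z z' = 0
    · rw [hE0, abs_zero, mul_zero, zero_mul, mul_zero]
      exact mul_nonneg hK0 (mul_nonneg (hu0 z) (hv0 z'))
    · have hblk := hEs z z' hE0
      -- splitting the exponentials
      set p : ℝ := ξ * (supDist y z : ℝ) with hp
      set q : ℝ := ξ * (supDist z' y' : ℝ) with hq
      have hp0 : 0 ≤ p := by positivity
      have hq0 : 0 ≤ q := by positivity
      have htri : t ≤ p + 2 + q := by
        have h1 := supDist_triangle_real y z y'
        have h2 := supDist_triangle_real z z' y'
        have h3 : (n : ℝ) ≤ (supDist y z : ℝ) + (supDist z z' : ℝ) + (supDist z' y' : ℝ) := by rw [hn]; linarith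
        have h4 : ξ * (n : ℝ) ≤ ξ * ((supDist y z : ℝ) + (supDist z z' : ℝ) + (supDist z' y' : ℝ)) :=
          mul_le_mul_of_nonneg_left h3 hξ.le
        rw [ht, hp, hq]; nlinarith
      have hexpA : Real.exp (-(α * p)) ≤ Real.exp (-(α / 2 * p)) * Real.exp (-(γ * p)) := by
        rw [← Real.exp_add]; apply Real.exp_le_exp.mpr; nlinarith
      have hexpB : Real.exp (-(β * q)) ≤ Real.exp (-(β / 2 * q)) * Real.exp (-(γ * q)) := by
        rw [← Real.exp_add]; apply Real.exp_le_exp.mpr; nlinarith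
      have hexpT : Real.exp (-(γ * p)) * Real.exp (-(γ * q)) ≤ Real.exp (2 * γ) * Real.exp (-(γ * t)) := by
        rw [← Real.exp_add, ← Real.exp_add]; apply Real.exp_le_exp.mpr; nlinarith
      have hA' : |A y z| ≤ a * (((ξ * max (1 : ℝ) (supDist y z : ℝ)) ^ 2)⁻¹ * (Real.exp (-(α / 2 * p)) *
          Real.exp (-(γ * p)))) := by
        refine (hA y z).trans ?_
        rw [← hp]
        gcongr
      have hB' : |B z' y'| ≤ b * (((ξ * max (1 : ℝ) (supDist z' y' : ℝ)) ^ 2)⁻¹ * (Real.exp (-(β / 2 * q)) *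
          Real.exp (-(γ * q)))) := by
        refine (hB z' y').trans ?_
        rw [← hq]
        gcongr
      set qa : ℝ := ((ξ * max (1 : ℝ) (supDist y z : ℝ)) ^ 2)⁻¹ with hqa
      set qb : ℝ := ((ξ * max (1 : ℝ) (supDist z' y' : ℝ)) ^ 2)⁻¹ with hqb
      have hqa0 : 0 ≤ qa := by positivity
      have hqb0 : 0 ≤ qb := by positivity
      calc ξ ^ P.d * (|A y z| * |E z z'| * |B z' y'|)
          ≤ ξ ^ P.d * ((a * (qa * (Real.exp (-(α / 2 * p)) * Real.exp (-(γ * p))))) * (e₁ * ξ ^ P.d) *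
              (b * (qb * (Real.exp (-(β / 2 * q)) * Real.exp (-(γ * q)))))) := by
            refine mul_le_mul_of_nonneg_left ?_ hξd
            refine mul_le_mul (mul_le_mul hA' (hE z z') (abs_nonneg _) (by positivity)) hB' (abs_nonneg _)
              (by positivity)
        _ = e₁ * (Real.exp (-(γ * p)) * Real.exp (-(γ * q))) *
              ((ξ ^ P.d * (a * (qa * Real.exp (-(α / 2 * p))))) * (ξ ^ P.d * (b * (qb * Real.exp (-(β / 2 * q)))))) := by
            ring
        _ ≤ e₁ * (Real.exp (2 * γ) * Real.exp (-(γ * t))) *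
              ((ξ ^ P.d * (a * (qa * Real.exp (-(α / 2 * p))))) * (ξ ^ P.d * (b * (qb * Real.exp (-(β / 2 * q)))))) := by
            have h0 : 0 ≤ (ξ ^ P.d * (a * (qa * Real.exp (-(α / 2 * p))))) *
                (ξ ^ P.d * (b * (qb * Real.exp (-(β / 2 * q))))) := by positivity
            exact mul_le_mul_of_nonneg_right (mul_le_mul_of_nonneg_left hexpT he) h0
        _ = K * (u z * v z') := by simp only [hK, hu, hv, hp, hq, hqa, hqb]; ring
  -- summing: the double sum factors
  have hsu : ∑ z, u z ≤ a * (1 + radialConst P.d (α / 2) ξ 0) :=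
    sum_const_mul_profile_le hd hξ hξ1 (half_pos hα) ha y
  have hsv : ∑ z', v z' ≤ b * (1 + radialConst P.d (β / 2) ξ 0) :=
    sum_const_mul_profile_le' hd hξ hξ1 (half_pos hβ) hb y'
  have hsum : ∑ z : Site P j, ∑ z' : Site P j, ξ ^ P.d * (|A y z| * |E z z'| * |B z' y'|) ≤
      K * ((∑ z, u z) * (∑ z', v z')) := by
    calc ∑ z : Site P j, ∑ z' : Site P j, ξ ^ P.d * (|A y z| * |E z z'| * |B z' y'|)
        ≤ ∑ z : Site P j, ∑ z' : Site P j, K * (u z * v z') :=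
          Finset.sum_le_sum fun z _ => Finset.sum_le_sum fun z' _ => hpt z z'
      _ = K * ((∑ z, u z) * (∑ z', v z')) := by
          rw [Finset.sum_mul_sum, Finset.mul_sum]
          refine Finset.sum_congr rfl fun z _ => ?_
          rw [Finset.mul_sum]
  have hRa : 0 ≤ 1 + radialConst P.d (α / 2) ξ 0 := by
    have := radialConst_nonneg P.d (half_pos hα) hξ.le 0; linarith
  have hRb : 0 ≤ 1 + radialConst P.d (β / 2) ξ 0 := by
    have := radialConst_nonneg P.d (half_pos hβ) hξ.le 0; linarith
  have hsum' : ∑ z : Site P j, ∑ z' : Site P j, ξ ^ P.d * (|A y z| * |E z z'| * |B z' y'|) ≤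
      K * ((a * (1 + radialConst P.d (α / 2) ξ 0)) * (b * (1 + radialConst P.d (β / 2) ξ 0))) := by
    refine hsum.trans (mul_le_mul_of_nonneg_left ?_ hK0)
    exact mul_le_mul hsu hsv (Finset.sum_nonneg fun z _ => hv0 z) (mul_nonneg ha hRa)
  -- the last exponential: `e^{−γt} ≤ 8γ^{−2}t^{−2}e^{−(γ/2)t}`
  have hexp : Real.exp (-(γ * t)) ≤ 8 * (γ ^ 2)⁻¹ * ((t ^ 2)⁻¹ * Real.exp (-(γ / 2 * t))) := by
    have h1 : Real.exp (-(γ / 2 * t)) ≤ 2 / (γ / 2 * t) ^ 2 := exp_neg_le_two_div_sq (by positivity)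
    have h2 : Real.exp (-(γ * t)) = Real.exp (-(γ / 2 * t)) * Real.exp (-(γ / 2 * t)) := by
      rw [← Real.exp_add]; congr 1; ring
    rw [h2]
    calc Real.exp (-(γ / 2 * t)) * Real.exp (-(γ / 2 * t)) ≤ (2 / (γ / 2 * t) ^ 2) * Real.exp (-(γ / 2 * t)) :=
          mul_le_mul_of_nonneg_right h1 (Real.exp_pos _).le
      _ = 8 * (γ ^ 2)⁻¹ * ((t ^ 2)⁻¹ * Real.exp (-(γ / 2 * t))) := by
          field_simp
          ring
  have hR : 0 ≤ (a * (1 + radialConst P.d (α / 2) ξ 0)) * (b * (1 + radialConst P.d (β / 2) ξ 0)) :=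
    mul_nonneg (mul_nonneg ha hRa) (mul_nonneg hb hRb)
  calc ∑ z : Site P j, ∑ z' : Site P j, ξ ^ P.d * (|A y z| * |E z z'| * |B z' y'|)
      ≤ K * ((a * (1 + radialConst P.d (α / 2) ξ 0)) * (b * (1 + radialConst P.d (β / 2) ξ 0))) := hsum'
    _ = e₁ * Real.exp (2 * γ) * ((a * (1 + radialConst P.d (α / 2) ξ 0)) * (b * (1 + radialConst P.d (β / 2) ξ 0))) *
          Real.exp (-(γ * t)) := by rw [hK]; ring
    _ ≤ e₁ * Real.exp (2 * γ) * ((a * (1 + radialConst P.d (α / 2) ξ 0)) * (b * (1 + radialConst P.d (β / 2) ξ 0))) *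
          (8 * (γ ^ 2)⁻¹ * ((t ^ 2)⁻¹ * Real.exp (-(γ / 2 * t)))) :=
        mul_le_mul_of_nonneg_left hexp (mul_nonneg (mul_nonneg he (Real.exp_pos _).le) hR)
    _ = _ := by rw [ht]; ring

end

end Literature.MathematicalPhysics.QuantumFieldTheory.Balaban1983to89.B3KernelConvolutionTorus
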